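import Literature.MathematicalPhysics.QuantumFieldTheory.BalabanBanachStep
import Summits.QuantumFields.YangMills.Theorems.ParabolicTrajectoryBalabanStepParabolicOrbitPrecompact
import Summits.QuantumFields.YangMills.Theorems.InfraredLiouvilleRepellerLemmaChartRepeller
import HarnessLib

/-!
# Route `InfraredLiouville`, item `RepellerLemma` — the free fixed point of Bałaban's step repels Wilson orbits

Support file for item `stmt-QuantumFields-9757` (`RepellerLemma`, card K2 "asymptotic freedom forbids infrared
freedom" of route `InfraredLiouville` on `YangMills`; INFORMAL at the time of writing, so nothing here closes it).
Specialisation of the abstract chart dynamics of `InfraredLiouvilleRepellerLemmaChartRepeller` to EVERY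
inhabitant `S : BalabanBanachStep G r M` of the tree's posited parabolic normal form of one complete
renormalisation step (no parity of `M`, no simplicity of `G` used — the sign `0 < b = b₀ log M` is a field of
the structure; inhabiting it for Wilson's action is the crux `BalabanStepParabolic` of route
`ParabolicTrajectory`, open):

* `exists_repellerRadius` (`'`) — a radius `0 < δ₁ ≤ δ` with `4 C δ₁ ≤ b`, `θ' δ₁ + C δ₁² ≤ δ₁` (and `b δ₁² ≤ 1`).
* `eventually_coupling_eq_zero_of_tendsto_freePoint` — if an orbit `F^[k] p₀` converges to the free fixed point
  `(0, 0)` then its coupling vanishes identically from some step on.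
* `freePoint_repels` / `localStableSet_subset_couplingZero` — the free point repels in its marginal direction;
  its local stable set lies in the hyperplane `{g = 0}`.
* `basin_orbit_escapes` — the BASIN form relevant to Wilson's action: there is `τ > 0` such that every orbit
  started anywhere in the basin `‖y‖ ≤ R` with coupling `0 < g ≤ τ` reaches a coupling of modulus `> τ`
  (positivity of the coupling and basin invariance along the way, `basin_orbit_pos`; the transient
  `θ'^k R` of `norm_iterate_snd_le`; then the box dynamics).
* `wilson_orbit_escapes` — in particular every Wilson orbit `F^[k] (g, yW g)`, `0 < g ≤ min τ g₀`: inside the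
  chart, the blocked effective couplings of Wilson's theory cannot stay near, let alone converge to, the free
  non-abelian glue theory.
* `repellerLemma_chart` — (eventually-zero coupling at the free point) ∧ (Wilson orbits escape), all binders
  explicit: the typed form of the item suggested to the planner, proved for every inhabitant.
* Quantitative form (abstract `inv_sq_step`, `inv_sq_le_of_forall_abs_le`, `exists_escape_le`; for inhabitants
  `balaban_exists_escape_le`): inside the repeller box `1/g_{k+1}² ≤ 1/g_k² − b/2`, so an orbit with coupling
  `g ≠ 0` leaves `{|g| ≤ δ₁}` after at most `2/(b g²) + 1 = 2/(b₀ log M · g²) + 1` block steps — an infrared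
  blow-up factor `M^k = exp(O(1/g²)) = exp(O(β))` (chart-level crossover UPPER bound; the matching lower bound
  `1/g_j² ≥ 1/g² − 2c₁ j` is `Theorems/BalabanStepParabolic/Negative/OrbitTransport.lean` §L).
-/

open Filter Topology
open Literature.MathematicalPhysics.QuantumFieldTheory

namespace Summit.QuantumFields.YangMills.Theorems.RepellerLemma

/-! ### Abstract quantitative part: the inverse-square recursion and the escape time -/

section Abstract

variable {E : Type} [NormedAddCommGroup E] {φ : ℝ → E → ℝ} {Ψ : ℝ → E → E} {b C δ δ₁ θ' : ℝ}

/-- Elementary: if `0 < a`, `a (1 + (b/2) a²) ≤ a'` and `b a² ≤ 1` (`0 ≤ b`), then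
`1/a'² ≤ 1/a² − b/2`. [folklore] -/
theorem inv_sq_step {a a' b : ℝ} (ha : 0 < a) (hb : 0 ≤ b) (hba : b * a ^ 2 ≤ 1)
    (h : a + b / 2 * a ^ 3 ≤ a') : 1 / a' ^ 2 ≤ 1 / a ^ 2 - b / 2 := by
  have ha2 : 0 < a ^ 2 := by positivity
  have ha' : 0 < a' := by
    have : 0 ≤ b / 2 * a ^ 3 := by positivity
    linarith
  -- `a'² ≥ a² (1 + (b/2) a²)² ≥ a² (1 + b a²)`
  have h1 : a ^ 2 * (1 + b * a ^ 2) ≤ a' ^ 2 := by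
    have e : a + b / 2 * a ^ 3 = a * (1 + b / 2 * a ^ 2) := by ring
    have h0 : 0 ≤ a * (1 + b / 2 * a ^ 2) := by positivity
    have h2 : (a * (1 + b / 2 * a ^ 2)) ^ 2 ≤ a' ^ 2 := by
      rw [e] at h
      exact pow_le_pow_left₀ h0 h 2
    have h3 : a ^ 2 * (1 + b * a ^ 2) ≤ (a * (1 + b / 2 * a ^ 2)) ^ 2 := by
      nlinarith [sq_nonneg (b / 2 * a ^ 2), ha2]
    exact h3.trans h2
  -- `1/(a² (1 + x)) ≤ (1/a²)(1 − x/2)` for `x = b a² ∈ [0, 1]`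
  have hx0 : 0 ≤ b * a ^ 2 := by positivity
  have hpos : 0 < a ^ 2 * (1 + b * a ^ 2) := by positivity
  calc 1 / a' ^ 2 ≤ 1 / (a ^ 2 * (1 + b * a ^ 2)) := one_div_le_one_div_of_le hpos h1
    _ ≤ 1 / a ^ 2 - b / 2 := by
        rw [div_le_iff₀ hpos]
        have e : (1 / a ^ 2 - b / 2) * (a ^ 2 * (1 + b * a ^ 2)) =
            1 + b * a ^ 2 / 2 - (b * a ^ 2) ^ 2 / 2 := by
          field_simp
          ring
        rw [e]
        nlinarith

/-- **Inverse-square decay along the orbit**: on the box (`δ₁ ≤ δ`, `4 C δ₁ ≤ b`, `θ' δ₁ + C δ₁² ≤ δ₁`,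
`b δ₁² ≤ 1`), an orbit with fibre started in `B̄_{δ₁}`, coupling `g₀ ≠ 0`, and couplings in `[-δ₁, δ₁]` before
time `k` satisfies `g_k ≠ 0` and `1/g_k² ≤ 1/g₀² − k b/2`. [folklore] -/
theorem inv_sq_le_of_forall_abs_le
    (H : ∀ g : ℝ, ∀ y : E, |g| ≤ δ → ‖y‖ ≤ δ →
      |φ g y - (g + b * g ^ 3)| ≤ C * (g ^ 4 + |g| ^ 3 * ‖y‖))
    (HΨ : ∀ g : ℝ, ∀ y : E, |g| ≤ δ → ‖y‖ ≤ δ → ‖Ψ g y‖ ≤ θ' * ‖y‖ + C * g ^ 2)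
    (hb : 0 < b) (hC : 0 ≤ C) (hθ' : 0 ≤ θ') (hδ₁δ : δ₁ ≤ δ) (h4 : 4 * C * δ₁ ≤ b)
    (hΨsmall : θ' * δ₁ + C * δ₁ ^ 2 ≤ δ₁) (hbδ : b * δ₁ ^ 2 ≤ 1)
    (p : ℕ → ℝ × E) (hp : ∀ k, (p (k + 1)).1 = φ (p k).1 (p k).2)
    (hp2 : ∀ k, (p (k + 1)).2 = Ψ (p k).1 (p k).2)
    (hy0 : ‖(p 0).2‖ ≤ δ₁) (hne : (p 0).1 ≠ 0) (k : ℕ) (hg : ∀ j < k, |(p j).1| ≤ δ₁) :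
    (p k).1 ≠ 0 ∧ 1 / (p k).1 ^ 2 ≤ 1 / (p 0).1 ^ 2 - k * (b / 2) := by
  induction k with
  | zero => exact ⟨hne, by simp⟩
  | succ k ih =>
    obtain ⟨hnek, ihk⟩ := ih fun j hj => hg j (hj.trans (Nat.lt_succ_self k))
    have hgk := hg k (Nat.lt_succ_self k)
    have hyk : ‖(p k).2‖ ≤ δ₁ :=
      norm_snd_le_of_forall_abs_le HΨ hC hθ' hδ₁δ hΨsmall p hp2 hy0 k
        fun j hj => hg j (hj.trans (Nat.lt_succ_self k))
    have hstep := abs_add_le_abs_map H hC hδ₁δ h4 hgk hyk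
    rw [← hp k] at hstep
    have ha : 0 < |(p k).1| := abs_pos.2 hnek
    have hba : b * |(p k).1| ^ 2 ≤ 1 :=
      (mul_le_mul_of_nonneg_left (pow_le_pow_left₀ (abs_nonneg _) hgk 2) hb.le).trans hbδ
    have hinv := inv_sq_step ha hb.le hba hstep
    rw [sq_abs, sq_abs] at hinv
    refine ⟨?_, ?_⟩
    · intro h0
      rw [h0] at hstep
      have : 0 < |(p k).1| + b / 2 * |(p k).1| ^ 3 := by positivity
      simp at hstep
      linarith
    · push_cast
      linarith

/-- **Escape time bound**: on the box as above, an orbit with fibre started in `B̄_{δ₁}` and coupling `g₀ ≠ 0`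
reaches `|g_k| > δ₁` at some time `k ≤ 2/(b g₀²) + 1`. [folklore] -/
theorem exists_escape_le
    (H : ∀ g : ℝ, ∀ y : E, |g| ≤ δ → ‖y‖ ≤ δ →
      |φ g y - (g + b * g ^ 3)| ≤ C * (g ^ 4 + |g| ^ 3 * ‖y‖))
    (HΨ : ∀ g : ℝ, ∀ y : E, |g| ≤ δ → ‖y‖ ≤ δ → ‖Ψ g y‖ ≤ θ' * ‖y‖ + C * g ^ 2)
    (hb : 0 < b) (hC : 0 ≤ C) (hθ' : 0 ≤ θ') (hδ₁δ : δ₁ ≤ δ) (h4 : 4 * C * δ₁ ≤ b)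
    (hΨsmall : θ' * δ₁ + C * δ₁ ^ 2 ≤ δ₁) (hbδ : b * δ₁ ^ 2 ≤ 1)
    (p : ℕ → ℝ × E) (hp : ∀ k, (p (k + 1)).1 = φ (p k).1 (p k).2)
    (hp2 : ∀ k, (p (k + 1)).2 = Ψ (p k).1 (p k).2)
    (hy0 : ‖(p 0).2‖ ≤ δ₁) (hne : (p 0).1 ≠ 0) :
    ∃ k : ℕ, (k : ℝ) ≤ 2 / (b * (p 0).1 ^ 2) + 1 ∧ δ₁ < |(p k).1| := by
  have hg0 : 0 < (p 0).1 ^ 2 := by positivity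
  have hT : 0 ≤ 2 / (b * (p 0).1 ^ 2) := by positivity
  set K : ℕ := ⌊2 / (b * (p 0).1 ^ 2)⌋₊ + 1 with hK
  have hKle : (K : ℝ) ≤ 2 / (b * (p 0).1 ^ 2) + 1 := by
    rw [hK]; push_cast
    linarith [Nat.floor_le hT]
  have hKgt : 2 / (b * (p 0).1 ^ 2) < K := by
    rw [hK]; push_cast
    exact Nat.lt_floor_add_one _
  by_contra hcon'
  have hcon : ∀ k : ℕ, (k : ℝ) ≤ 2 / (b * (p 0).1 ^ 2) + 1 → |(p k).1| ≤ δ₁ :=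
    fun k hk => not_lt.1 fun h => hcon' ⟨k, hk, h⟩
  have hbox : ∀ j < K, |(p j).1| ≤ δ₁ := by
    intro j hj
    refine hcon j ?_
    have : (j : ℝ) ≤ K := by exact_mod_cast hj.le
    linarith
  obtain ⟨hneK, hinv⟩ := inv_sq_le_of_forall_abs_le H HΨ hb hC hθ' hδ₁δ h4 hΨsmall hbδ p hp hp2 hy0 hne
    K hbox
  have hposK : 0 < 1 / (p K).1 ^ 2 := by positivity
  have hlt : 1 / (p 0).1 ^ 2 - K * (b / 2) < 0 := by
    have e : 1 / (p 0).1 ^ 2 = 2 / (b * (p 0).1 ^ 2) * (b / 2) := by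
      field_simp
    rw [e]
    nlinarith
  linarith

end Abstract

/-! ### For every inhabitant of Bałaban's step -/

section Balaban

open Summit.QuantumFields.YangMills.Theorems.BalabanStepParabolic

variable {G : Type} [Group G] [TopologicalSpace G] [IsTopologicalGroup G] [CompactSpace G]
  [MeasurableSpace G] [BorelSpace G] {r : LatticeRep G} {M : ℕ} (S : BalabanBanachStep G r M)

/-- The parabolic remainder bound of the coupling map on the chart (first half of `remainder`). [folklore] -/
theorem remainder_fst (g : ℝ) (y : S.E) (hg : |g| ≤ S.δ) (hy : ‖y‖ ≤ S.δ) :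
    |S.φ g y - (g + S.b * g ^ 3)| ≤ S.C * (g ^ 4 + |g| ^ 3 * ‖y‖) :=
  (S.remainder g y hg hy).1

/-- The fibre bound `‖Ψ g y‖ ≤ θ' ‖y‖ + C g²` on the chart ball (from the basin contraction). [folklore] -/
theorem fibre_bound (g : ℝ) (y : S.E) (hg : |g| ≤ S.δ) (hy : ‖y‖ ≤ S.δ) :
    ‖S.Ψ g y‖ ≤ S.θ' * ‖y‖ + S.C * g ^ 2 :=
  S.norm_Ψ_le hg (hy.trans S.δ_le_R)

/-- Orbits of `S.F` satisfy the coupling recursion. [folklore] -/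
theorem orbit_fst (p₀ : ℝ × S.E) (k : ℕ) :
    (S.F^[k + 1] p₀).1 = S.φ (S.F^[k] p₀).1 (S.F^[k] p₀).2 :=
  iterate_succ_fst S p₀ k

/-- Orbits of `S.F` satisfy the fibre recursion. [folklore] -/
theorem orbit_snd (p₀ : ℝ × S.E) (k : ℕ) :
    (S.F^[k + 1] p₀).2 = S.Ψ (S.F^[k] p₀).1 (S.F^[k] p₀).2 :=
  iterate_succ_snd S p₀ k

/-- **A repeller radius exists** for every inhabitant: `0 < δ₁ ≤ δ` with `4 C δ₁ ≤ b` and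
`θ' δ₁ + C δ₁² ≤ δ₁`. [folklore] -/
theorem exists_repellerRadius :
    ∃ δ₁ : ℝ, 0 < δ₁ ∧ δ₁ ≤ S.δ ∧ 4 * S.C * δ₁ ≤ S.b ∧ S.θ' * δ₁ + S.C * δ₁ ^ 2 ≤ δ₁ :=
  exists_repellerRadius_of_consts S.δ_pos S.b_pos S.C_pos.le S.θ'_lt_one

/-- **A repeller radius with `b δ₁² ≤ 1`** for every inhabitant. [folklore] -/
theorem exists_repellerRadius' :
    ∃ δ₁ : ℝ, 0 < δ₁ ∧ δ₁ ≤ S.δ ∧ 4 * S.C * δ₁ ≤ S.b ∧ S.θ' * δ₁ + S.C * δ₁ ^ 2 ≤ δ₁ ∧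
      S.b * δ₁ ^ 2 ≤ 1 :=
  exists_repellerRadius_of_consts' S.δ_pos S.b_pos S.C_pos.le S.θ'_lt_one

/-- **No orbit of Bałaban's step reaches the free fixed point from non-zero coupling**: if
`F^[k] p₀ → (0, 0)` then the coupling coordinate vanishes identically from some step on. [folklore] -/
theorem eventually_coupling_eq_zero_of_tendsto_freePoint (p₀ : ℝ × S.E)
    (h : Tendsto (fun k => S.F^[k] p₀) atTop (𝓝 0)) : ∀ᶠ k in atTop, (S.F^[k] p₀).1 = 0 := by
  obtain ⟨δ₁, hδ₁, hδ₁δ, h4, -⟩ := exists_repellerRadius S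
  exact eventually_fst_eq_zero_of_tendsto (remainder_fst S) S.C_pos.le hδ₁ hδ₁δ h4
    (fun k => S.F^[k] p₀) (orbit_fst S p₀) h

/-- **The free fixed point repels** (Gaussian point = IR repeller in its marginal direction): there is `δ₁ > 0`
such that every orbit started with fibre in `B̄_{δ₁}` and coupling `g ≠ 0` reaches `|g| > δ₁`. [folklore] -/
theorem freePoint_repels :
    ∃ δ₁ > 0, ∀ p₀ : ℝ × S.E, ‖p₀.2‖ ≤ δ₁ → p₀.1 ≠ 0 → ∃ k, δ₁ < |(S.F^[k] p₀).1| := by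
  obtain ⟨δ₁, hδ₁, hδ₁δ, h4, hΨ⟩ := exists_repellerRadius S
  refine ⟨δ₁, hδ₁, fun p₀ hy hne => ?_⟩
  exact exists_escape (remainder_fst S) (fibre_bound S) S.b_pos S.C_pos.le S.θ'_nonneg hδ₁δ h4 hΨ
    (fun k => S.F^[k] p₀) (orbit_fst S p₀) (orbit_snd S p₀) hy hne

/-- **Local stable set in the hyperplane of zero coupling**: there is `δ₁ > 0` such that an orbit with fibre
started in `B̄_{δ₁}` whose couplings all stay in `[-δ₁, δ₁]` started at `g = 0`. [folklore] -/
theorem localStableSet_subset_couplingZero :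
    ∃ δ₁ > 0, ∀ p₀ : ℝ × S.E, ‖p₀.2‖ ≤ δ₁ → (∀ k, |(S.F^[k] p₀).1| ≤ δ₁) → p₀.1 = 0 := by
  obtain ⟨δ₁, hδ₁, hδ₁δ, h4, hΨ⟩ := exists_repellerRadius S
  refine ⟨δ₁, hδ₁, fun p₀ hy hg => ?_⟩
  exact fst_eq_zero_of_forall_abs_le (remainder_fst S) (fibre_bound S) S.b_pos S.C_pos.le S.θ'_nonneg
    hδ₁δ h4 hΨ (fun k => S.F^[k] p₀) (orbit_fst S p₀) (orbit_snd S p₀) hy hg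

/-- **Positive couplings stay positive and fibres stay in the basin** while the coupling is at most `τ`, for
`τ ≤ δ` with `C τ² (τ + R) ≤ 1/2` and `C τ² ≤ (1 − θ') R`. [folklore] -/
theorem basin_orbit_pos (τ : ℝ) (hτδ : τ ≤ S.δ) (hA : S.C * τ ^ 2 * (τ + S.R) ≤ 1 / 2)
    (hB : S.C * τ ^ 2 ≤ (1 - S.θ') * S.R) (q : ℝ × S.E) (hq0 : 0 < q.1) (hqR : ‖q.2‖ ≤ S.R)
    (k : ℕ) (hk : ∀ j < k, |(S.F^[j] q).1| ≤ τ) :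
    0 < (S.F^[k] q).1 ∧ ‖(S.F^[k] q).2‖ ≤ S.R := by
  induction k with
  | zero => exact ⟨hq0, hqR⟩
  | succ k ih =>
    obtain ⟨hg0, hyR⟩ := ih fun j hj => hk j (hj.trans (Nat.lt_succ_self k))
    have hgτ' := hk k (Nat.lt_succ_self k)
    set g := (S.F^[k] q).1 with hg
    set y := (S.F^[k] q).2 with hy
    have hgτ : g ≤ τ := (le_abs_self g).trans hgτ'
    have hgδ : |g| ≤ S.δ := hgτ'.trans hτδ
    have hC := S.C_pos.le
    have hR := S.R_pos.le
    refine ⟨?_, ?_⟩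
    · rw [orbit_fst]
      have hrem := S.remainder_basin g y hgδ hyR
      rw [abs_of_pos hg0] at hrem
      have hlow := (abs_le.1 hrem).1
      have hg2 : g ^ 2 ≤ τ ^ 2 := pow_le_pow_left₀ hg0.le hgτ 2
      have hsmall : S.C * g ^ 2 * (g + S.R) ≤ 1 / 2 := by
        calc S.C * g ^ 2 * (g + S.R) ≤ S.C * τ ^ 2 * (τ + S.R) := by
              apply mul_le_mul (mul_le_mul_of_nonneg_left hg2 hC) (by linarith) (by positivity)
                (by positivity)
          _ ≤ 1 / 2 := hA
      have hyR' : g ^ 3 * ‖y‖ ≤ g ^ 3 * S.R := mul_le_mul_of_nonneg_left hyR (by positivity)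
      have hb := S.b_pos
      have hg3 : 0 < g ^ 3 := by positivity
      -- φ g y ≥ g + b g³ − C (g⁴ + g³ R) = g (1 − C g² (g + R)) + b g³ > 0
      nlinarith [mul_le_mul_of_nonneg_left hyR' hC, mul_pos hb hg3]
    · rw [orbit_snd]
      have hg2 : g ^ 2 ≤ τ ^ 2 := pow_le_pow_left₀ hg0.le hgτ 2
      exact S.norm_Ψ_le_R hgδ hyR ((mul_le_mul_of_nonneg_left hg2 hC).trans hB)

/-- **Basin escape** ("asymptotic freedom forbids infrared freedom", chart level): there is `τ > 0` such that every
orbit of the step started ANYWHERE in the basin `‖y‖ ≤ R` with coupling `0 < g ≤ τ` reaches a coupling of modulus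
`> τ` — the blocked effective couplings cannot stay near the free non-abelian glue theory. (After the transient
`θ'^k R` the fibre is inside the repeller box, where the coupling grows by `(b/2) g³` per step.) [folklore] -/
theorem basin_orbit_escapes :
    ∃ τ > 0, ∀ q : ℝ × S.E, 0 < q.1 → q.1 ≤ τ → ‖q.2‖ ≤ S.R → ∃ k, τ < |(S.F^[k] q).1| := by
  obtain ⟨δ₁, hδ₁, hδ₁δ, h4, hΨ⟩ := exists_repellerRadius S
  have hC := S.C_pos
  have hR := S.R_pos
  have hθ0 := S.θ'_nonneg
  have hθ1 := S.θ'_lt_one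
  have h1θ : 0 < 1 - S.θ' := by linarith
  -- choice of τ
  have ev0 : ∀ᶠ τ in 𝓝[>] (0 : ℝ), τ ∈ Set.Ioc 0 δ₁ := Ioc_mem_nhdsGT hδ₁
  have evA : ∀ᶠ τ in 𝓝[>] (0 : ℝ), S.C * τ ^ 2 * (τ + S.R) ≤ 1 / 2 := by
    have hc : Tendsto (fun τ : ℝ => S.C * τ ^ 2 * (τ + S.R)) (𝓝 0) (𝓝 0) := by
      have : Continuous fun τ : ℝ => S.C * τ ^ 2 * (τ + S.R) := by fun_prop
      simpa using this.tendsto 0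
    exact (hc.mono_left nhdsWithin_le_nhds).eventually (eventually_le_nhds (by norm_num))
  have evB : ∀ᶠ τ in 𝓝[>] (0 : ℝ), S.C * τ ^ 2 ≤ (1 - S.θ') * S.R := by
    have hc : Tendsto (fun τ : ℝ => S.C * τ ^ 2) (𝓝 0) (𝓝 0) := by
      have : Continuous fun τ : ℝ => S.C * τ ^ 2 := by fun_prop
      simpa using this.tendsto 0
    exact (hc.mono_left nhdsWithin_le_nhds).eventually (eventually_le_nhds (by positivity))
  have evC : ∀ᶠ τ in 𝓝[>] (0 : ℝ), S.C * τ ^ 2 / (1 - S.θ') ≤ δ₁ / 2 := by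
    have hc : Tendsto (fun τ : ℝ => S.C * τ ^ 2 / (1 - S.θ')) (𝓝 0) (𝓝 0) := by
      have : Continuous fun τ : ℝ => S.C * τ ^ 2 / (1 - S.θ') := by fun_prop
      simpa using this.tendsto 0
    exact (hc.mono_left nhdsWithin_le_nhds).eventually (eventually_le_nhds (by positivity))
  obtain ⟨τ, ⟨hτ0, hτδ₁⟩, hA, hB, hCτ⟩ := (ev0.and (evA.and (evB.and evC))).exists
  have hτδ : τ ≤ S.δ := hτδ₁.trans hδ₁δ
  refine ⟨τ, hτ0, fun q hq0 hqτ hqR => ?_⟩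
  by_contra hcon'
  have hcon : ∀ k, |(S.F^[k] q).1| ≤ τ := fun k => not_lt.1 fun h => hcon' ⟨k, h⟩
  -- positivity of all couplings, fibres in the basin
  have hpos : ∀ k, 0 < (S.F^[k] q).1 ∧ ‖(S.F^[k] q).2‖ ≤ S.R := fun k =>
    basin_orbit_pos S τ hτδ hA hB q hq0 hqR k fun j _ => hcon j
  -- transient decay of the fibre
  have hdecay : ∀ n, ‖(S.F^[n] q).2‖ ≤ S.θ' ^ n * S.R + δ₁ / 2 := by
    intro n
    have h := (norm_iterate_snd_le S hτδ hB q hqR n fun j _ =>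
      ⟨(hpos j).1.le, (le_abs_self _).trans (hcon j)⟩).2
    calc ‖(S.F^[n] q).2‖ ≤ S.θ' ^ n * ‖q.2‖ + S.C * τ ^ 2 / (1 - S.θ') := h
      _ ≤ S.θ' ^ n * S.R + δ₁ / 2 := by gcongr
  -- after k₀ steps the fibre is inside the repeller box
  obtain ⟨k₀, hk₀⟩ := exists_pow_lt_of_lt_one (show 0 < δ₁ / 2 / S.R by positivity) hθ1
  have hk₀' : S.θ' ^ k₀ * S.R ≤ δ₁ / 2 := by
    have := (lt_div_iff₀ hR).1 hk₀
    linarith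
  set q' := S.F^[k₀] q with hq'
  have hy' : ‖q'.2‖ ≤ δ₁ := by
    have := hdecay k₀
    linarith
  have hne : q'.1 ≠ 0 := (hpos k₀).1.ne'
  obtain ⟨k, hk⟩ := exists_escape (remainder_fst S) (fibre_bound S) S.b_pos hC.le hθ0 hδ₁δ h4 hΨ
    (fun k => S.F^[k] q') (orbit_fst S q') (orbit_snd S q') hy' hne
  have hiter : S.F^[k] q' = S.F^[k + k₀] q := (Function.iterate_add_apply S.F k k₀ q).symm
  rw [hiter] at hk
  have := hcon (k + k₀)
  linarith

/-- **Wilson orbits leave every small coupling window** (the in-chart content of "asymptotic freedom forbids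
infrared freedom" for Wilson's action): there is `τ > 0` such that for every bare coupling `0 < g ≤ min τ g₀`
the orbit `F^[k] (g, yW g)` of the Wilson point reaches a coupling of modulus `> τ`; in particular it does not
converge to the free fixed point while keeping its couplings in `[-τ, τ]`. [folklore] -/
theorem wilson_orbit_escapes :
    ∃ τ > 0, ∀ g : ℝ, 0 < g → g ≤ τ → g ≤ S.g₀ → ∃ k, τ < |(S.F^[k] (g, S.yW g)).1| := by
  obtain ⟨τ, hτ, h⟩ := basin_orbit_escapes S
  exact ⟨τ, hτ, fun g hg0 hgτ hg₀ => h (g, S.yW g) hg0 hgτ (S.norm_yW_le g ⟨hg0.le, hg₀⟩)⟩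

/-- **Chart-level crossover bound for Bałaban's step**: there is `δ₁ > 0` such that every orbit with fibre in
`B̄_{δ₁}` and coupling `g ≠ 0` leaves `{|g| ≤ δ₁}` after at most `2/(b g²) + 1 = 2/(b₀ log M · g²) + 1` block steps
— an infrared blow-up factor `M^k = exp(O(1/g²)) = exp(O(β))`. [folklore] -/
theorem balaban_exists_escape_le :
    ∃ δ₁ > 0, ∀ p₀ : ℝ × S.E, ‖p₀.2‖ ≤ δ₁ → p₀.1 ≠ 0 →
      ∃ k : ℕ, (k : ℝ) ≤ 2 / (S.b * p₀.1 ^ 2) + 1 ∧ δ₁ < |(S.F^[k] p₀).1| := by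
  obtain ⟨δ₁, hδ₁, hδ₁δ, h4, hΨ, hbδ⟩ := exists_repellerRadius' S
  refine ⟨δ₁, hδ₁, fun p₀ hy hne => ?_⟩
  exact exists_escape_le (remainder_fst S) (fibre_bound S) S.b_pos S.C_pos.le S.θ'_nonneg hδ₁δ h4 hΨ hbδ
    (fun k => S.F^[k] p₀) (orbit_fst S p₀) (orbit_snd S p₀) hy hne

end Balaban

/-- **The repeller lemma, chart form, for all inhabitants** — the typed statement this unit suggests to the
planner for item `stmt-QuantumFields-9757` (all binders explicit, no hypothesis on `G`, `r`, `M`): for every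
inhabitant of Bałaban's step, (i) an orbit converging to the free fixed point has identically vanishing coupling
from some step on, and (ii) there is `τ > 0` such that every Wilson orbit started at bare coupling
`0 < g ≤ min τ g₀` reaches a coupling of modulus `> τ`. [folklore] -/
theorem repellerLemma_chart :
    ∀ (G : Type) [Group G] [TopologicalSpace G] [IsTopologicalGroup G] [CompactSpace G] [MeasurableSpace G]
      [BorelSpace G] (r : LatticeRep G) (M : ℕ) (S : BalabanBanachStep G r M),
      (∀ p₀ : ℝ × S.E, Tendsto (fun k => S.F^[k] p₀) atTop (𝓝 0) → ∀ᶠ k in atTop, (S.F^[k] p₀).1 = 0) ∧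
      (∃ τ > 0, ∀ g : ℝ, 0 < g → g ≤ τ → g ≤ S.g₀ → ∃ k, τ < |(S.F^[k] (g, S.yW g)).1|) :=
  fun _G _ _ _ _ _ _ _r _M S =>
    ⟨fun p₀ h => eventually_coupling_eq_zero_of_tendsto_freePoint S p₀ h, wilson_orbit_escapes S⟩

end Summit.QuantumFields.YangMills.Theorems.RepellerLemma
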